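import Literature.Barriers.Parity.LinearSieveOptimality
import HarnessLib

/-!
# `LinearSieveOptimality` — companion file: Buchstab's identity for Selberg's sets

Topic `Literature/Barriers/Parity`, companion of the catalogue entry `LinearSieveOptimality.lean`
(Selberg's extremal examples for the linear sieve, Greaves 2001 §4.5.1). This file collects the
COMBINATORIAL (finite, exact) inputs of the proof of Greaves' Theorem 4.5.1.1; everything is
PROVED, there are no new definitions and no named facts.

* `card_eq_setSifted_add_sum`, `setSifted_buchstab` — Buchstab's identity for a finite set
  `A ⊆ ℕ`: `S(A, P(z₁)) = S(A, P(z)) + ∑_{z₁ ≤ p < z} #{a ∈ A : p ∣ a, (a, P(p)) = 1}`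
  (`z₁ ≤ z`; classify the elements coprime to `P(z₁)` but not to `P(z)` by their least prime
  factor) [Greaves (3.1.3.3)];
* `card_filter_dvd_coprime_selbergSet` — for Selberg's sets `𝒜 = 𝒜^{(−)^r}(X)` and a prime `p`,
  `#{a ∈ 𝒜 : p ∣ a, (a, P(p)) = 1} = S(𝒜^{(−)^{r+1}}(X/p), P(p))` ("`𝒜_p = 𝒜^{(−)^{r+1}}(X/p)`":
  `a = pm` with `2X/p ≤ m < 4X/p`, `Ω(m) = Ω(a) − 1`), hence
  `selbergSet_buchstab` — Greaves (4.5.1.10) with `ρ ≡ 1`: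
  `ψ_r(X, σ) = ψ_r(X, s) + ∑_{X^{1/σ} ≤ p < X^{1/s}} ψ_{r+1}(X/p, log X/log p − 1)`, here in the
  form `S(𝒜^{(−)^r}(X), P(z₁)) = S(𝒜^{(−)^r}(X), P(z)) + ∑_{z₁ ≤ p < z} S(𝒜^{(−)^{r+1}}(X/p), P(p))`;
* `setSifted_anti` (monotonicity in `z`), `selbergSet_add_two` (only the parity of `r` matters);
* `selbergSet_one_sifted_le_sq` — the boundary case `s = 2` of the Special Situation: if
  `z⁴ > 4X` the survivors of `𝒜⁻(X)` under `P(z)` are products of two primes in `[z, 4X/z)`, so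
  `S(𝒜⁻(X), P(z)) ≤ π(4X/z)²` (used with `z = √X`: `S(𝒜⁻(X), P(√X)) ≤ π(4√X)² = o(X/log X)`);
* `card_Ico_filter_prime` — `#{p prime : 2X ≤ p < 4X} = #{p < 4X} − #{p < 2X}`.

## References

* G. Greaves, *Sieves in Number Theory*, Springer (2001), §4.5.1 (1.9)–(1.10) and (3.1.3.3)
  [Greaves2001] (held: `lit read book:greavesnd-sieves-number-theory`, PDF pp. 124–125).
-/

noncomputable section

open Finset
open scoped ArithmeticFunction.Omega

namespace Literature.Barriers.Parity

open Literature.NumberTheory.Sieve (primesProdBelow coprime_primesProdBelow_iff)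

/-! ### Buchstab's identity for finite sets -/

/-- **Buchstab's identity, one-parameter form**: for a finite set `A ⊆ ℕ` and real `z`,
`#A = S(A, P(z)) + ∑_{p < z} #{a ∈ A : p ∣ a, (a, P(p)) = 1}` — every `a ∈ A` not coprime to
`P(z)` is counted exactly once, at its least prime factor `p < z` (Mathlib's `Nat.minFac`, with
`minFac 0 = 2`, so `a = 0` needs no exception).
[cite: Greaves2001, (3.1.3.3)] -/
theorem card_eq_setSifted_add_sum (A : Finset ℕ) (z : ℝ) :
    #A = setSifted A (primesProdBelow z) +
      ∑ p ∈ Nat.primesBelow ⌈z⌉₊, #(A.filter fun a => p ∣ a ∧ a.Coprime (primesProdBelow p)) := by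
  classical
  set k : ℕ → ℕ := fun a => if a.Coprime (primesProdBelow z) then 0 else a.minFac with hk
  have hmem : ∀ a ∈ A, k a ∈ insert 0 (Nat.primesBelow ⌈z⌉₊) := by
    intro a _
    by_cases hc : a.Coprime (primesProdBelow z)
    · simp [hk, hc]
    · simp only [hk, hc, if_false]
      refine mem_insert_of_mem ?_
      rw [coprime_primesProdBelow_iff] at hc
      push Not at hc
      obtain ⟨q, hq, hqa⟩ := hc
      rw [Nat.mem_primesBelow] at hq ⊢
      have ha1 : a ≠ 1 := fun h1 => hq.2.ne_one (Nat.dvd_one.mp (h1 ▸ hqa))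
      exact ⟨(Nat.minFac_le_of_dvd hq.2.two_le hqa).trans_lt hq.1, Nat.minFac_prime ha1⟩
  have h0 : (0 : ℕ) ∉ Nat.primesBelow ⌈z⌉₊ := fun h =>
    Nat.not_prime_zero (Nat.prime_of_mem_primesBelow h)
  rw [card_eq_sum_card_fiberwise hmem, sum_insert h0]
  congr 1
  · -- the fibre over `0`: the elements coprime to `P(z)`
    unfold setSifted
    congr 1
    ext a
    simp only [mem_filter, hk]
    refine and_congr_right fun _ => ⟨fun h => ?_, fun hc => by rw [if_pos hc]⟩
    by_contra hc
    rw [if_neg hc] at h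
    exact (Nat.minFac_pos a).ne' h
  · refine sum_congr rfl fun p hp => ?_
    congr 1
    ext a
    simp only [mem_filter]
    refine and_congr_right fun ha => ?_
    have hpp : p.Prime := Nat.prime_of_mem_primesBelow hp
    constructor
    · intro h
      simp only [hk] at h
      have hc : ¬ a.Coprime (primesProdBelow z) := by
        intro hc
        rw [if_pos hc] at h
        exact hpp.ne_zero h.symm
      rw [if_neg hc] at h
      have ha1 : a ≠ 1 := by
        rintro rfl
        exact hc (Nat.coprime_one_left _)
      refine ⟨h ▸ Nat.minFac_dvd a, ?_⟩
      rw [coprime_primesProdBelow_iff]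
      intro q hq hqa
      rw [Nat.mem_primesBelow, Nat.ceil_natCast] at hq
      have := Nat.minFac_le_of_dvd hq.2.two_le hqa
      omega
    · rintro ⟨hpa, hcop⟩
      have hc : ¬ a.Coprime (primesProdBelow z) := by
        rw [coprime_primesProdBelow_iff]
        push Not
        exact ⟨p, hp, hpa⟩
      simp only [hk, hc, if_false]
      have ha1 : a ≠ 1 := by
        rintro rfl
        exact hpp.ne_one (Nat.dvd_one.mp hpa)
      rcases (Nat.minFac_le_of_dvd hpp.two_le hpa).lt_or_eq with hlt | heq
      · exfalso
        rw [coprime_primesProdBelow_iff] at hcop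
        exact hcop a.minFac (by
          rw [Nat.mem_primesBelow, Nat.ceil_natCast]
          exact ⟨hlt, Nat.minFac_prime ha1⟩) (Nat.minFac_dvd a)
      · exact heq

/-- The primes in `[z₁, z)` as a difference of `primesBelow`. [folklore] -/
theorem primesBelow_sdiff_eq_filter {z₁ z : ℝ} :
    Nat.primesBelow ⌈z⌉₊ \ Nat.primesBelow ⌈z₁⌉₊ =
      (Nat.primesBelow ⌈z⌉₊).filter (fun p : ℕ => z₁ ≤ (p : ℝ)) := by
  ext p
  simp only [mem_sdiff, mem_filter, Nat.mem_primesBelow, not_and', not_lt]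
  constructor
  · rintro ⟨⟨hpz, hp⟩, hnot⟩
    exact ⟨⟨hpz, hp⟩, Nat.ceil_le.mp (hnot hp)⟩
  · rintro ⟨⟨hpz, hp⟩, hle⟩
    exact ⟨⟨hpz, hp⟩, fun _ => Nat.ceil_le.mpr hle⟩

/-- **Buchstab's identity** for a finite set `A ⊆ ℕ` and `z₁ ≤ z`:
`S(A, P(z₁)) = S(A, P(z)) + ∑_{z₁ ≤ p < z} #{a ∈ A : p ∣ a, (a, P(p)) = 1}`.
[cite: Greaves2001, (3.1.3.3)] -/
theorem setSifted_buchstab (A : Finset ℕ) {z₁ z : ℝ} (hz : z₁ ≤ z) :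
    setSifted A (primesProdBelow z₁) = setSifted A (primesProdBelow z) +
      ∑ p ∈ (Nat.primesBelow ⌈z⌉₊).filter (fun p : ℕ => z₁ ≤ (p : ℝ)),
        #(A.filter fun a => p ∣ a ∧ a.Coprime (primesProdBelow p)) := by
  have h1 := card_eq_setSifted_add_sum A z₁
  have h2 := card_eq_setSifted_add_sum A z
  have hsub : Nat.primesBelow ⌈z₁⌉₊ ⊆ Nat.primesBelow ⌈z⌉₊ := fun p hp => by
    rw [Nat.mem_primesBelow] at hp ⊢
    exact ⟨hp.1.trans_le (Nat.ceil_mono hz), hp.2⟩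
  have hsum := sum_sdiff hsub
    (f := fun p => #(A.filter fun a => p ∣ a ∧ a.Coprime (primesProdBelow p)))
  rw [primesBelow_sdiff_eq_filter] at hsum
  omega

/-! ### Selberg's sets: `𝒜_p = 𝒜^{(−)^{r+1}}(X/p)` -/

/-- `0 ∉ 𝒜^{(−)^r}(X)`. [folklore] -/
theorem zero_not_mem_selbergSet (r : ℕ) (X : ℝ) : 0 ∉ selbergSet r X := by
  intro h
  rw [mem_selbergSet] at h
  obtain ⟨⟨h2, h4⟩, _⟩ := h
  push_cast at h2 h4
  linarith

/-- A prime `p` is coprime to `P(p) = ∏_{q < p} q`. [folklore] -/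
theorem prime_coprime_primesProdBelow_self {p : ℕ} (hp : p.Prime) :
    p.Coprime (primesProdBelow p) := by
  rw [coprime_primesProdBelow_iff]
  intro q hq hqp
  rw [Nat.mem_primesBelow, Nat.ceil_natCast] at hq
  exact absurd ((Nat.prime_dvd_prime_iff_eq hq.2 hp).mp hqp) hq.1.ne

/-- **`𝒜_p = p · 𝒜^{(−)^{r+1}}(X/p)` on the elements free of prime factors `< p`**: for a prime
`p`, the `a ∈ 𝒜^{(−)^r}(X)` with `p ∣ a` and `(a, P(p)) = 1` are exactly the `p·m` with
`m ∈ 𝒜^{(−)^{r+1}}(X/p)`, `(m, P(p)) = 1` (`2X ≤ pm < 4X ↔ 2X/p ≤ m < 4X/p`,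
`Ω(pm) = Ω(m) + 1`). [cite: Greaves2001, §4.5.1 (1.9)–(1.10)] -/
theorem filter_dvd_coprime_selbergSet_eq_image {p : ℕ} (hp : p.Prime) (r : ℕ) (X : ℝ) :
    (selbergSet r X).filter (fun a => p ∣ a ∧ a.Coprime (primesProdBelow p)) =
      ((selbergSet (r + 1) (X / p)).filter fun m => m.Coprime (primesProdBelow p)).image
        (p * ·) := by
  have hp0 : (0 : ℝ) < p := by exact_mod_cast hp.pos
  have hpcop := prime_coprime_primesProdBelow_self hp
  ext a
  simp only [mem_filter, mem_image, mem_selbergSet]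
  constructor
  · rintro ⟨⟨⟨h2, h4⟩, hpar⟩, ⟨m, rfl⟩, hcop⟩
    push_cast at h2 h4
    have hm0 : m ≠ 0 := by
      rintro rfl
      simp only [Nat.cast_zero, mul_zero] at h2 h4
      linarith
    refine ⟨m, ⟨⟨⟨?_, ?_⟩, ?_⟩, Nat.Coprime.coprime_mul_left hcop⟩, rfl⟩
    · rw [mul_div_assoc', div_le_iff₀ hp0]
      linarith
    · rw [mul_div_assoc', lt_div_iff₀ hp0]
      linarith
    · rw [ArithmeticFunction.cardFactors_mul hp.ne_zero hm0,
        ArithmeticFunction.cardFactors_apply_prime hp] at hpar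
      omega
  · rintro ⟨m, ⟨⟨⟨h2, h4⟩, hpar⟩, hcop⟩, rfl⟩
    rw [mul_div_assoc', div_le_iff₀ hp0] at h2
    rw [mul_div_assoc', lt_div_iff₀ hp0] at h4
    have hm0 : m ≠ 0 := by
      rintro rfl
      simp only [Nat.cast_zero, zero_mul] at h2 h4
      linarith
    refine ⟨⟨⟨?_, ?_⟩, ?_⟩, dvd_mul_right p m, Nat.Coprime.mul_left hpcop hcop⟩
    · push_cast
      linarith
    · push_cast
      linarith
    · rw [ArithmeticFunction.cardFactors_mul hp.ne_zero hm0,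
        ArithmeticFunction.cardFactors_apply_prime hp]
      omega

/-- Hence `#{a ∈ 𝒜^{(−)^r}(X) : p ∣ a, (a, P(p)) = 1} = S(𝒜^{(−)^{r+1}}(X/p), P(p))`
("`𝒜_p = 𝒜^{(−)^{r+1}}(X/p)`", `ρ(p) = 1`). [cite: Greaves2001, §4.5.1 (1.10)] -/
theorem card_filter_dvd_coprime_selbergSet {p : ℕ} (hp : p.Prime) (r : ℕ) (X : ℝ) :
    #((selbergSet r X).filter fun a => p ∣ a ∧ a.Coprime (primesProdBelow p)) =
      setSifted (selbergSet (r + 1) (X / p)) (primesProdBelow p) := by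
  rw [filter_dvd_coprime_selbergSet_eq_image hp,
    card_image_of_injective _ (mul_right_injective₀ hp.ne_zero)]
  rfl

/-- **Buchstab's identity for Selberg's sets** (Greaves (4.5.1.10) with `ρ ≡ 1`): for `z₁ ≤ z`,
`S(𝒜^{(−)^r}(X), P(z₁)) = S(𝒜^{(−)^r}(X), P(z)) + ∑_{z₁ ≤ p < z} S(𝒜^{(−)^{r+1}}(X/p), P(p))`;
with `z₁ = X^{1/σ}`, `z = X^{1/s}` and `P(p) = P((X/p)^{1/t})`, `t = log X/log p − 1`, this is
`ψ_r(X, σ) = ψ_r(X, s) + ∑_{X^{1/σ} ≤ p < X^{1/s}} ψ_{r+1}(X/p, log X/log p − 1)`.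
[cite: Greaves2001, §4.5.1 (1.10)] -/
theorem selbergSet_buchstab (r : ℕ) (X : ℝ) {z₁ z : ℝ} (hz : z₁ ≤ z) :
    setSifted (selbergSet r X) (primesProdBelow z₁) =
      setSifted (selbergSet r X) (primesProdBelow z) +
        ∑ p ∈ (Nat.primesBelow ⌈z⌉₊).filter (fun p : ℕ => z₁ ≤ (p : ℝ)),
          setSifted (selbergSet (r + 1) (X / p)) (primesProdBelow p) := by
  rw [setSifted_buchstab (selbergSet r X) hz]
  refine congrArg _ (sum_congr rfl fun p hp => ?_)
  exact card_filter_dvd_coprime_selbergSet (Nat.prime_of_mem_primesBelow (mem_filter.mp hp).1) r X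

/-- Only the parity of `r` matters: `𝒜^{(−)^{r+2}} = 𝒜^{(−)^r}` (`φ_{r+2} = φ_r`, "`F = φ₀ = φ₂`").
[cite: Greaves2001, §4.5.1 (1.7)] -/
theorem selbergSet_add_two (r : ℕ) (X : ℝ) : selbergSet (r + 2) X = selbergSet r X := by
  unfold selbergSet
  refine filter_congr fun a _ => ?_
  constructor <;> intro h <;> omega

/-- `φ_{r+2} = φ_r`. [cite: Greaves2001, §4.5.1 (1.7)] -/
theorem linearSievePhi_add_two (r : ℕ) : linearSievePhi (r + 2) = linearSievePhi r := by
  unfold linearSievePhi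
  rw [show (r + 2) % 2 = r % 2 by omega]

/-- `S(A, P(z))` is non-increasing in `z`. [folklore] -/
theorem setSifted_anti (A : Finset ℕ) {z z' : ℝ} (h : z ≤ z') :
    setSifted A (primesProdBelow z') ≤ setSifted A (primesProdBelow z) := by
  unfold setSifted
  refine card_le_card fun a ha => ?_
  rw [mem_filter] at ha ⊢
  refine ⟨ha.1, (coprime_primesProdBelow_iff _ _).mpr fun q hq =>
    (coprime_primesProdBelow_iff _ _).mp ha.2 q ?_⟩
  rw [Nat.mem_primesBelow] at hq ⊢
  exact ⟨hq.1.trans_le (Nat.ceil_mono h), hq.2⟩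

/-- `S(A, P) ≤ #A`. [folklore] -/
theorem setSifted_le_card (A : Finset ℕ) (P : ℕ) : setSifted A P ≤ #A :=
  card_filter_le _ _

/-- `#𝒜^{(−)^r}(X) ≤ 2X + 1` (the set lives in `[2X, 4X)`). [folklore] -/
theorem card_selbergSet_le (r : ℕ) {X : ℝ} (hX : 0 ≤ X) : (#(selbergSet r X) : ℝ) ≤ 2 * X + 1 := by
  have h1 : #(selbergSet r X) ≤ ⌈4 * X⌉₊ - ⌈2 * X⌉₊ := by
    unfold selbergSet
    exact (card_filter_le _ _).trans (Nat.card_Ico _ _).le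
  have hAB : ⌈2 * X⌉₊ ≤ ⌈4 * X⌉₊ := Nat.ceil_mono (by linarith)
  have h2 : ((⌈4 * X⌉₊ - ⌈2 * X⌉₊ : ℕ) : ℝ) = ⌈4 * X⌉₊ - ⌈2 * X⌉₊ := Nat.cast_sub hAB
  have h3 : (⌈4 * X⌉₊ : ℝ) < 4 * X + 1 := Nat.ceil_lt_add_one (by linarith)
  have h4 : 2 * X ≤ (⌈2 * X⌉₊ : ℝ) := Nat.le_ceil _
  calc (#(selbergSet r X) : ℝ) ≤ ((⌈4 * X⌉₊ - ⌈2 * X⌉₊ : ℕ) : ℝ) := by exact_mod_cast h1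
    _ = ⌈4 * X⌉₊ - ⌈2 * X⌉₊ := h2
    _ ≤ 2 * X + 1 := by linarith

/-! ### The boundary case `s = 2` of the Special Situation: products of two primes -/

/-- **Survivors of `𝒜⁻(X)` beyond `(4X)^{1/4}` are products of two primes**: if `X ≥ 1`,
`z > 0` and `z⁴ > 4X`, then every `a ∈ 𝒜⁻(X)` coprime to `P(z)` is `p·q` with primes
`z ≤ p ≤ q < 4X/z` (it has an even number, at least `1` and fewer than `4`, of prime factors
`≥ z`), whence `S(𝒜⁻(X), P(z)) ≤ π(4X/z)²`. With `z = √X` this bounds the semiprimes surviving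
at the sifting limit `s = 2` by `π(4√X)² = O(X/log² X) = o(X V(P(√X)))`, the boundary case of
"the left side of (1.5) is zero" (which holds verbatim only for `s < 2`).
[cite: Greaves2001, §4.5.1 "A Special Situation"] -/
theorem selbergSet_one_sifted_le_sq {X z : ℝ} (hX : 1 ≤ X) (hz : 0 < z) (hzX : 4 * X < z ^ 4) :
    setSifted (selbergSet 1 X) (primesProdBelow z) ≤ (Nat.primeCounting ⌊4 * X / z⌋₊) ^ 2 := by
  classical
  unfold setSifted
  set S := (selbergSet 1 X).filter fun a : ℕ => a.Coprime (primesProdBelow z) with hS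
  set T := Nat.primesLE ⌊4 * X / z⌋₊ with hT
  have hTcard : #T = Nat.primeCounting ⌊4 * X / z⌋₊ := Nat.primesLE_card_eq_primeCounting _
  have hzc : z ≤ (⌈z⌉₊ : ℝ) := Nat.le_ceil z
  have hmemT : ∀ n : ℕ, n.Prime → (n : ℝ) < 4 * X / z → n ∈ T := by
    intro n hn hlt
    show n ∈ Nat.primesBelow (⌊4 * X / z⌋₊ + 1)
    rw [Nat.mem_primesBelow]
    exact ⟨Nat.lt_succ_of_le (Nat.le_floor hlt.le), hn⟩
  -- structure of the elements of `S`
  have hstruct : ∀ a ∈ S, a.minFac ∈ T ∧ a / a.minFac ∈ T ∧ a.minFac * (a / a.minFac) = a := by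
    intro a ha
    rw [hS, mem_filter, mem_selbergSet] at ha
    obtain ⟨⟨⟨ha2, ha4⟩, hpar⟩, hcop⟩ := ha
    have ha0 : a ≠ 0 := by
      rintro rfl
      push_cast at ha2
      linarith
    have ha1 : a ≠ 1 := by
      rintro rfl
      push_cast at ha2
      linarith
    have hfac : ∀ q ∈ a.primeFactorsList, ⌈z⌉₊ ≤ q := fun q hq =>
      ceil_le_of_mem_primeFactorsList_of_coprime hcop hq
    have hpow := pow_cardFactors_le ha0 hfac
    have hΩ3 : Ω a ≤ 3 := by
      by_contra h4
      have h4' : 4 ≤ Ω a := by omega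
      have hc : ⌈z⌉₊ ^ 4 ≤ a := (Nat.pow_le_pow_right (Nat.ceil_pos.mpr hz) h4').trans hpow
      have hc' : ((⌈z⌉₊ : ℝ)) ^ 4 ≤ (a : ℝ) := by exact_mod_cast hc
      have hz4 : z ^ 4 ≤ ((⌈z⌉₊ : ℝ)) ^ 4 := pow_le_pow_left₀ hz.le hzc 4
      linarith
    have hΩ1 : 1 ≤ Ω a := ArithmeticFunction.cardFactors_pos_iff_one_lt.mpr (by omega)
    have hΩ2 : Ω a = 2 := by
      norm_num at hpar
      omega
    set p := a.minFac with hpdef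
    have hp : p.Prime := Nat.minFac_prime ha1
    have hpa : p ∣ a := Nat.minFac_dvd a
    have hqa : p * (a / p) = a := Nat.mul_div_cancel' hpa
    have hq0 : a / p ≠ 0 := by
      intro h
      rw [h, mul_zero] at hqa
      exact ha0 hqa.symm
    have hΩq : Ω (a / p) = 1 := by
      have := ArithmeticFunction.cardFactors_mul hp.ne_zero hq0
      rw [hqa, ArithmeticFunction.cardFactors_apply_prime hp, hΩ2] at this
      omega
    have hq : (a / p).Prime := ArithmeticFunction.cardFactors_eq_one_iff_prime.mp hΩq
    -- lower bounds `p, q ≥ z`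
    have hpz : z ≤ (p : ℝ) := hzc.trans (by
      exact_mod_cast hfac p ((Nat.mem_primeFactorsList ha0).mpr ⟨hp, hpa⟩))
    have hqz : z ≤ ((a / p : ℕ) : ℝ) := hzc.trans (by
      exact_mod_cast hfac (a / p) ((Nat.mem_primeFactorsList ha0).mpr ⟨hq, Nat.div_dvd_of_dvd hpa⟩))
    -- upper bounds from `p q = a < 4X`
    have hprod : (p : ℝ) * ((a / p : ℕ) : ℝ) < 4 * X := by
      have : ((p * (a / p) : ℕ) : ℝ) = (a : ℝ) := by rw [hqa]
      push_cast at this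
      rw [this]
      exact ha4
    have hp0 : (0 : ℝ) ≤ p := Nat.cast_nonneg _
    have hq0' : (0 : ℝ) ≤ ((a / p : ℕ) : ℝ) := Nat.cast_nonneg _
    have hp_lt : (p : ℝ) < 4 * X / z := by
      rw [lt_div_iff₀ hz]
      calc (p : ℝ) * z ≤ p * ((a / p : ℕ) : ℝ) := by gcongr
        _ < 4 * X := hprod
    have hq_lt : ((a / p : ℕ) : ℝ) < 4 * X / z := by
      rw [lt_div_iff₀ hz]
      calc ((a / p : ℕ) : ℝ) * z ≤ ((a / p : ℕ) : ℝ) * p := by gcongr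
        _ = p * ((a / p : ℕ) : ℝ) := mul_comm _ _
        _ < 4 * X := hprod
    exact ⟨hmemT p hp hp_lt, hmemT _ hq hq_lt, hqa⟩
  -- the injection `a ↦ (p, a/p)`
  calc #S ≤ #(T ×ˢ T) := by
        refine card_le_card_of_injOn (fun a => (a.minFac, a / a.minFac)) (fun a ha => ?_) ?_
        · rw [mem_coe, mem_product]
          exact ⟨(hstruct a ha).1, (hstruct a ha).2.1⟩
        · intro a ha b hb hab
          simp only [Prod.mk.injEq] at hab
          obtain ⟨h1, h2⟩ := hab
          have ea := (hstruct a ha).2.2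
          have eb := (hstruct b hb).2.2
          rw [h2] at ea
          rw [h1] at ea
          exact ea.symm.trans eb
    _ = #T ^ 2 := by rw [card_product, sq]
    _ = (Nat.primeCounting ⌊4 * X / z⌋₊) ^ 2 := by rw [hTcard]

/-! ### Counting the primes in `[2X, 4X)` -/

/-- `#{p prime : ⌈2X⌉ ≤ p < ⌈4X⌉} = #{p < 4X} − #{p < 2X}` for `X ≥ 0`. [folklore] -/
theorem card_Ico_filter_prime {X : ℝ} (hX : 0 ≤ X) :
    #((Ico ⌈2 * X⌉₊ ⌈4 * X⌉₊).filter Nat.Prime) =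
      #(Nat.primesBelow ⌈4 * X⌉₊) - #(Nat.primesBelow ⌈2 * X⌉₊) := by
  have hAB : ⌈2 * X⌉₊ ≤ ⌈4 * X⌉₊ := Nat.ceil_mono (by linarith)
  have hsub : Nat.primesBelow ⌈2 * X⌉₊ ⊆ Nat.primesBelow ⌈4 * X⌉₊ := fun p hp => by
    rw [Nat.mem_primesBelow] at hp ⊢
    exact ⟨hp.1.trans_le hAB, hp.2⟩
  have heq : (Ico ⌈2 * X⌉₊ ⌈4 * X⌉₊).filter Nat.Prime =
      Nat.primesBelow ⌈4 * X⌉₊ \ Nat.primesBelow ⌈2 * X⌉₊ := by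
    ext p
    simp only [mem_filter, mem_Ico, mem_sdiff, Nat.mem_primesBelow]
    constructor
    · rintro ⟨⟨h1, h2⟩, hp⟩
      exact ⟨⟨h2, hp⟩, fun h => absurd h.1 (not_lt.mpr h1)⟩
    · rintro ⟨⟨h2, hp⟩, h⟩
      refine ⟨⟨?_, h2⟩, hp⟩
      by_contra hlt
      push Not at hlt
      exact h ⟨hlt, hp⟩
  rw [heq, card_sdiff_of_subset hsub]

end Literature.Barriers.Parity
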